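import Summits.Langlands.Langlands.Theses.PhantomRMYoshida
import Summits.Langlands.Langlands.Theorems.DyadicOddResidueSectorComplementStubEpsTransport
import Summits.Langlands.Langlands.Theorems.DyadicOddResidueSectorComplementStubEpsArtinEq
import Summits.Langlands.Langlands.Theorems.IrreducibilityBySelfDualityReciprocityUpToIrreducibilityCorrespondsConj
import Summits.Langlands.Langlands.Theorems.PhantomRMYoshidaPhantomRMJunctionSplit
import Summits.Langlands.Langlands.Theorems.DyadicOddResidueSectorComplementRankTwoAssembly
import Summits.Langlands.Langlands.Theorems.PhantomRMYoshidaPhantomRMJunctionGenericRigidity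
import Summits.Langlands.Langlands.Theorems.PhantomRMYoshidaPhantomRMJunctionInvariantMeasureGLQuot
import Summits.Langlands.Langlands.Theorems.IrreducibilityBySelfDualityReciprocityUpToIrreducibilityRPoleOrderInvariants
import Literature.NumberTheory.GaloisRepresentations.HenniartGaloisSideCharacterisation
import Literature.NumberTheory.Automorphic.RankinSelbergLocalTwistProofs
import Literature.NumberTheory.Automorphic.LocalLanglandsDatumProofs
import Literature.NumberTheory.Automorphic.LocalComponentBJGenericProofs
import Literature.NumberTheory.Automorphic.LocalLanglandsGLOne
import Literature.NumberTheory.Automorphic.LocalConstantsUniquenessProofs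
import Literature.NumberTheory.Automorphic.LocalLanglandsGLIndecomposable
import Literature.NumberTheory.Automorphic.InvariantMeasureGLModUnipotent
import Summits.Langlands.Langlands.Theorems.IrreducibilityBySelfDualityReciprocityUpToIrreducibilityRStringDefs
import Summits.Langlands.Langlands.Theorems.PhantomRMYoshidaPhantomRMJunctionDualProbe
import Summits.Langlands.Langlands.Theorems.PhantomRMYoshidaPhantomRMJunctionStringModelAdmissible
import Mathlib.RepresentationTheory.Irreducible
import HarnessLib

/-!
# LINE SKELETON `PhantomRMJunctionOfPieces` — crux stmt-Langlands-13643 `PhantomRMYoshida.PhantomRMJunction`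

Lead prover-line-stmt-Langlands-13643-c19-0, 2026-08-17 (cycle 4 of the line; cycle 1 = lead c16, 2 = c17, 3 = c18).
One by-name skeleton with a single layer of SEVEN registered stubs (= stubs_max) over the crux-strategist's PROVED
transport glue `N → U → A′ → B′ → Langlands` (p150610).

`PhantomRMJunction := ∀ _ : PhantomRMSector, _root_.Langlands` is the route's D-0027 frame item (the rest of
`GL_n` reciprocity).  The line decomposes `Langlands` itself along the seams of the 2026-08-17 re-type
(`∀ F, Nonempty (ReciprocityData F) ∧ ∀ Rec n>0 hcpt, (A) ∧ (B)`) and obtains the junction by weakening.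
HONESTY CAVEAT carried over from the strategist: the sector hypothesis is bound and NOT used (no typed
assembly toward `Langlands` can consume it non-vacuously: `Theorems/PhantomRMYoshidaPhantomRMJunction.lean`,
`not_phantomRMJunction_iff`).

History.  c18 (v4/v5): the rank ≥ 3 rigidity stub of c17 was misstated (no `localLanglands_gl` hypothesis) and was
replaced by named-fact stubs of print; piece U (generic rigidity of pinned data in EVERY rank) was PROVED modulo
them — LANDED p157386 + p159547 `Theorems/PhantomRMYoshidaPhantomRMJunctionGenericRigidity.lean`; (Fν) the invariant
measure on `GL_m(F) ⧸ U_m(F)` was CLOSED by the 17925 lead's p159583.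
c19 RESHAPE.  v6 (by-name alignment with the sibling cruxes 17925 / 18745): the conjunction stub (F2 ∧ F3) was split
into F2 `localLanglands_gl_indecomposable` (T0) and F3 = Henniart 2002 Thm 1.7 (a) on the GALOIS side in INVARIANT
form (verbatim 17925's registered S-17a-B; the root-multiplicity form that U consumes is DERIVED, `henniart2002_thm17a`,
from F3 and 17925's LANDED pole-order lemma p162414, imported by name).  v7 (this file): the THREE T0 named facts
S_N1 / S6 / F2 are merged into ONE conjunction stub `stub_localNamedFacts` (each conjunct verbatim the siblings'
stub texts; never delegated) to free slots, and F3 — the one leaf of the line that is a THEOREM of linear algebra —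
is DERIVED (`isEquivalent_of_finrank_invariants_tprod_eq`, sorry-free glue) from three registered stubs:
F3a `stub_dualProbe` (admissible dual probes on coordinates computing `dim Hom_WD(X, σ)`), F3c
`stub_stringModel_admissible` (the standard string `ρ ⊗ Sp(a)` over an irreducible head is Frobenius-semisimple and
indecomposable), F3d `stub_isEquivalent_of_finrank_homWD_stringModel_eq` (Thm 1.7 (a) in `Hom` form — Deligne's
string decomposition + `Hom` out of a string + Henniart's counting; the side of crux 17925's lead, whose vocabulary
`…RStringDefs` (`homWD`, `stringModel`) is imported by name).  v8 (this file): F3a and F3c are CLOSED — LANDED by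
the c19 wave-1 workers as p164959 `…DualProbe.lean` and p164972 `…StringModelAdmissible.lean`, imported by name; the
line's open provable leaf is now exactly F3d.

Stubs (the ONLY sorries of this file are inside `stub_*`; one layer; 5 registered open of stubs_max 7;
`stub_avatarConjugate`, (Fν), F3a, F3c are closed and no longer stubs):
* N  — `stub_localNamedFacts` (S_N1 Deligne's canonical local constants = 17930's `stub_canonicalLocalConstants` =
  17925's `stub_exists_localEpsilonSystem_forall_isCanonical`; S6 `localLanglands_gl`; F2 `localLanglands_gl_indecomposable`);
* U  — S6 + F2 (inside LNF) + F3d + (F3a p164959, F3c p164972, Fν p159583: closed): the induction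
  `pinnedRecRigidity_of_localLanglandsInputs` is LANDED (p157386);
* A′ — `stub_weakExistenceIrreducible` (W_irr, open core of (A)), `stub_pairCompatibility` (LGC_∃: Taylor Conj 7 at
  every finite place for SOME pinned datum, open), avatar conjugacy (CLOSED — LANDED p150228, re-proved inline);
* B′ — `stub_weakAutomorphy` (B_w, open core of (B)) and `stub_pairCompatibility` again.
Composition: §1 N, §2 U, §3 A′/B′ (the strategist's birth compositions with hypotheses instead of stub
references), §4 the strategist's transport glue `langlands_of_pieces` (LANDED p150610, imported by name),
§5 `PhantomRMJunction_of` (eight hypotheses = the piece inputs) and `PhantomRMJunction_proof` BY NAME.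
-/

noncomputable section

set_option linter.dupNamespace false

open scoped MatrixGroups NumberField TensorProduct Polynomial
open Module MeasureTheory NumberField IsDedekindDomain Filter
open Literature.NumberTheory.Automorphic Literature.NumberTheory.GaloisRepresentations
open Literature.NumberTheory.GaloisRepresentations.WeilGroup
open Summit.Langlands
open Summit.Langlands.Langlands.Theorems.ReciprocityRigidity

namespace Summit.Langlands.Langlands.Cruxes.PhantomRMJunction.OfPieces

/-! ## §0 The seven registered stubs (and the two closed former stubs) -/

/-- **Stub LNF — the three LOCAL NAMED FACTS of print (T0 LITERATURE DEBT, never delegated), as one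
conjunction** (c19 v7: merged to free stub slots for the provable leaf F3; each conjunct is VERBATIM the text of the
sibling cruxes' registered stubs, so each closes by name when its `_holds` lands):
(S_N1) Deligne's local constants normalised against THE canonical Artin maps — `∃ 𝓔, ∀ E, (𝓔.artin E).IsCanonical`,
pointwise definitionally the named fact `nonempty_localEpsilonSystem_isCanonical F` (Deligne 1973 Thm 4.1 + 6.5;
= 17930's `stub_canonicalLocalConstants`, 17925's `stub_exists_localEpsilonSystem_forall_isCanonical`);
(S6) the local Langlands correspondence for `GL_n` with Henniart's uniqueness on supercuspidals — the named fact
`localLanglands_gl` (Harris–Taylor 2001 Thm A; Henniart 2000; Henniart 1993 Thm 1.1; = 17925's / 18745's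
`stub_localLanglands_gl`);
(F2) `localLanglands_gl_indecomposable` (p157134: supercuspidal ↔ irreducible parameter, indecomposable parameters
are parameters of everywhere-generic classes; Henniart 2002 Thm 1.5 (i), §2.7, §2.9; = 18745's
`stub_localLanglands_gl_indecomposable`).
[cite: Deligne1973, Thm. 4.1] [cite: HarrisTaylorAMS2001, Thm. A] [cite: Henniarts1993, Thm 1.1]
[cite: HenniartBSMF2002, Thm. 1.5 (i), §2.7 and §2.9] -/
theorem stub_localNamedFacts :
    (∀ (F : Type) [Field F] [ValuativeRel F] [TopologicalSpace F] [IsNonarchimedeanLocalField F], ∃ 𝓔 : Literature.NumberTheory.Automorphic.LocalEpsilonSystem F, ∀ (E : Type) [Field E] [ValuativeRel E] [TopologicalSpace E] [IsNonarchimedeanLocalField E] [Algebra F E] [FiniteDimensional F E], (𝓔.artin E).IsCanonical) ∧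
    (∀ (F : Type) [Field F] [ValuativeRel F] [TopologicalSpace F] [IsNonarchimedeanLocalField F] (hmul : @IsFrobPow.mul F _ _ _ _) (huniq : @IsFrobPow.unique F _ _ _ _) (hn : absInertia_normal F) (hex : @exists_isFrobPow F _ _ _ _) (hns : @WeilGroup.exists_subgroup_le_inertia_isOpen_of_continuous F _ _ _ _) (d : LocalArtinData F) (𝓔 : LocalEpsilonSystem F) (hd : 𝓔.artin F = d), localLanglands_gl F hmul huniq hn hex hns d 𝓔 hd) ∧
    (∀ (F : Type) [Field F] [ValuativeRel F] [TopologicalSpace F] [IsNonarchimedeanLocalField F] (hmul : @IsFrobPow.mul F _ _ _ _) (huniq : @IsFrobPow.unique F _ _ _ _) (hn : absInertia_normal F) (hex : @exists_isFrobPow F _ _ _ _) (hns : @WeilGroup.exists_subgroup_le_inertia_isOpen_of_continuous F _ _ _ _) (d : LocalArtinData F) (𝓔 : LocalEpsilonSystem F) (hd : 𝓔.artin F = d), localLanglands_gl_indecomposable F hmul huniq hn hex hns d 𝓔 hd) := by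
  sorry

/-- (S_N1) projected from `stub_localNamedFacts`. [cite: Deligne1973, Thm. 4.1] -/
theorem canonicalLocalConstants : ∀ (F : Type) [Field F] [ValuativeRel F] [TopologicalSpace F] [IsNonarchimedeanLocalField F], ∃ 𝓔 : Literature.NumberTheory.Automorphic.LocalEpsilonSystem F, ∀ (E : Type) [Field E] [ValuativeRel E] [TopologicalSpace E] [IsNonarchimedeanLocalField E] [Algebra F E] [FiniteDimensional F E], (𝓔.artin E).IsCanonical :=
  stub_localNamedFacts.1

/-- (S6) projected from `stub_localNamedFacts`. [cite: HarrisTaylorAMS2001, Thm. A] -/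
theorem localLanglands_gl_all :
    ∀ (F : Type) [Field F] [ValuativeRel F] [TopologicalSpace F] [IsNonarchimedeanLocalField F]
      (hmul : @IsFrobPow.mul F _ _ _ _) (huniq : @IsFrobPow.unique F _ _ _ _)
      (hn : absInertia_normal F) (hex : @exists_isFrobPow F _ _ _ _)
      (hns : @WeilGroup.exists_subgroup_le_inertia_isOpen_of_continuous F _ _ _ _)
      (d : LocalArtinData F) (𝓔 : LocalEpsilonSystem F) (hd : 𝓔.artin F = d),
      localLanglands_gl F hmul huniq hn hex hns d 𝓔 hd :=
  stub_localNamedFacts.2.1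

/-- (F2) projected from `stub_localNamedFacts`. [cite: HenniartBSMF2002, Thm. 1.5 (i)] -/
theorem localLanglands_gl_indecomposable_all :
    ∀ (F : Type) [Field F] [ValuativeRel F] [TopologicalSpace F] [IsNonarchimedeanLocalField F]
      (hmul : @IsFrobPow.mul F _ _ _ _) (huniq : @IsFrobPow.unique F _ _ _ _)
      (hn : absInertia_normal F) (hex : @exists_isFrobPow F _ _ _ _)
      (hns : @WeilGroup.exists_subgroup_le_inertia_isOpen_of_continuous F _ _ _ _)
      (d : LocalArtinData F) (𝓔 : LocalEpsilonSystem F) (hd : 𝓔.artin F = d),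
      localLanglands_gl_indecomposable F hmul huniq hn hex hns d 𝓔 hd :=
  stub_localNamedFacts.2.2

/-! ### F3 — Henniart 2002 Thm 1.7 (a), Galois side: THREE registered stubs and sorry-free glue

F3 (invariant form, verbatim 17925's S-17a-B) ⟸ F3a `dualProbe` (CLOSED p164959; every finite-dimensional Weil–Deligne
representation `X` has an ADMISSIBLE DUAL PROBE on coordinates: a `τ` on `Fin (dim X) → ℂ`, Frobenius-semisimple /
indecomposable when `X` is, whose Weil–Deligne invariants against any `σ` count `Hom_WD(X, σ)` — transport of the
contragredient `X^∨`, `V ⊗ U^∨ ≅ Hom(U, V)`) + F3c `stringModel_admissible` (CLOSED p164972; the standard string `ρ ⊗ Sp(a)` over an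
irreducible head is Frobenius-semisimple and indecomposable) + F3d `stub_isEquivalent_of_finrank_homWD_stringModel_eq`
(Thm 1.7 (a) in `Hom` FORM: a non-irreducible Frobenius-semisimple `σ` of dimension `n` is determined by
`dim Hom_WD(ρ ⊗ Sp(a), σ)` over irreducible `ρ` and `a ≥ 1` with `a · dim ρ < n` — Deligne's string decomposition, `Hom`
out of a string, Henniart's counting §4; the side held by crux 17925's lead, vocabulary `…RStringDefs`). -/

/-- **F3a — admissible dual probes: CLOSED** (LANDED p164959 `Theorems/PhantomRMYoshidaPhantomRMJunctionDualProbe.lean`,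
wave-1 worker of lead c19, derived from crux 17925's landed transport/dual/bridge lemmas p164318 + p163907; cited by name).
Every Weil–Deligne representation `X` on a finite-dimensional `U` has a probe `τ` on `Fin (dim U) → ℂ` (coordinates of
`X^∨`) which is Frobenius-semisimple / indecomposable when `X` is and whose Weil–Deligne invariants against any `σ` count
`Hom_WD(X, σ)`. [cite: TateCorvallis1979, (4.1.6)] -/
theorem dualProbe : ∀ (F : Type) [Field F] [ValuativeRel F] [TopologicalSpace F] [IsNonarchimedeanLocalField F] (U : Type) [AddCommGroup U] [Module ℂ U] [FiniteDimensional ℂ U] (X : WeilDeligneRep F ℂ U), ∃ τ : WeilDeligneRep F ℂ (Fin (Module.finrank ℂ U) → ℂ), (X.IsFrobSemisimple → τ.IsFrobSemisimple) ∧ (X.IsIndecomposable → τ.IsIndecomposable) ∧ ∀ (V : Type) [AddCommGroup V] [Module ℂ V] [FiniteDimensional ℂ V] (σ : WeilDeligneRep F ℂ V), Module.finrank ℂ ↥(LinearMap.ker (σ.tprod τ).N ⊓ (σ.tprod τ).ρ.invariants) = Module.finrank ℂ ↥(Summit.Langlands.Langlands.Theorems.ReciprocityUpToIrreducibilityR.homWD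 X σ) :=
  Summit.Langlands.Langlands.Theorems.PhantomRMJunctionOfPieces.stub_dualProbe

/-- **F3c — the standard string over an irreducible head is an admissible probe: CLOSED** (LANDED p164972
`Theorems/PhantomRMYoshidaPhantomRMJunctionStringModelAdmissible.lean`, wave-1 worker of lead c19; cited by name).
For `ρ` irreducible continuous finite-dimensional and `a ≥ 1`, `stringModel ρ hρ a = ρ ⊗ Sp(a)` is Frobenius-semisimple
and indecomposable (socle argument). [cite: TateCorvallis1979, (4.1.4)–(4.1.5)] -/
theorem stringModel_admissible : ∀ (F : Type) [Field F] [ValuativeRel F] [TopologicalSpace F] [IsNonarchimedeanLocalField F] (H : Type) [AddCommGroup H] [Module ℂ H] [FiniteDimensional ℂ H] (ρ : Representation ℂ (WeilGroup F) H) (hρ : WeilGroup.IsContinuousRep ρ), ρ.IsIrreducible → ∀ a : ℕ, 0 < a → (Summit.Langlands.Langlands.Theorems.ReciprocityUpToIrreducibilityR.stringModel ρ hρ a).IsFrobSemisimple ∧ (Summit.Langlands.Langlands.Theorems.ReciprocityUpToIrreducibilityR.stringModel ρ hρ a).IsIndecomposable :=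
  Summit.Langlands.Langlands.Theorems.PhantomRMJunctionOfPieces.stub_stringModel_admissible

/-- **Stub F3d — Henniart 2002 Thm 1.7 (a), Galois side, `Hom` FORM.**  Let `n ≥ 2`, `σ` a Frobenius-semisimple
Weil–Deligne representation on `Fin n → ℂ` which is NOT irreducible, `σ'` a Frobenius-semisimple one.  If for every
irreducible continuous `ρ` of `W_F` on a finite-dimensional `H` and every `a ≥ 1` with `a · dim H < n` the spaces
`Hom_WD(ρ ⊗ Sp(a), σ)` and `Hom_WD(ρ ⊗ Sp(a), σ')` have the same dimension, then `σ ≅ σ'` (Deligne's structure theorem: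
`σ`, `σ'` are direct sums of strings `ρ_i ⊗ Sp(b_i)`; `dim Hom_WD(ρ ⊗ Sp(a), ρ_i ⊗ Sp(b_i)) = 1` iff `ρ` is one of the
top `a` slots `ρ_i ⊗ ‖·‖^j`, `b_i - a ≤ j ≤ b_i - 1`, else `0` (Schur); Henniart's counting recovers the multiset of
strings from these numbers for `a · dim ρ ≤ n - 1` unless `σ` is irreducible).  The side of crux stmt-Langlands-17925's
lead (`…RStringDefs`, `…RStringBasics`, …). [cite: HenniartBSMF2002, Thm. 1.7 (a) and §4] [cite: TateCorvallis1979, (4.1.5)] -/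
theorem stub_isEquivalent_of_finrank_homWD_stringModel_eq : ∀ (F : Type) [Field F] [ValuativeRel F] [TopologicalSpace F] [IsNonarchimedeanLocalField F] (n : ℕ), 2 ≤ n → ∀ (σ σ' : WeilDeligneRep F ℂ (Fin n → ℂ)), σ.IsFrobSemisimple → σ'.IsFrobSemisimple → ¬ σ.IsIrreducible → (∀ (H : Type) [AddCommGroup H] [Module ℂ H] [FiniteDimensional ℂ H] (ρ : Representation ℂ (WeilGroup F) H) (hρ : WeilGroup.IsContinuousRep ρ), ρ.IsIrreducible → ∀ a : ℕ, 0 < a → a * Module.finrank ℂ H < n → Module.finrank ℂ ↥(Summit.Langlands.Langlands.Theorems.ReciprocityUpToIrreducibilityR.homWD (Summit.Langlands.Langlands.Theorems.ReciprocityUpToIrreducibilityR.stringModel ρ hρ a) σ) = Module.finrank ℂ ↥(Summit.Langlands.Langlands.Theorems.ReciprocityUpToIrreducibilityR.homWD (Summit.Langlands.Langlands.Theorems.ReciprocityUpToIrreducibilityR.stringModel ρ hρ a) σ')) → σ.IsEquivalent σ' := by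
  sorry

/-- **F3 — Henniart 2002, Thm. 1.7 (a), Galois side, INVARIANT FORM** (verbatim the registered S-17a-B of crux
stmt-Langlands-17925, formerly this line's registered stub; c19 v7: now DERIVED, sorry-free, from F3a + F3c + F3d):
for `n ≥ 2`, a Frobenius-semisimple non-irreducible `σ` and a Frobenius-semisimple `σ'` on `Fin n → ℂ` whose
Weil–Deligne invariants against every indecomposable Frobenius-semisimple `τ` of dimension `0 < r < n` have equal
dimensions are isomorphic.  Proof: probe with the admissible dual probes (F3a) of the standard strings `ρ ⊗ Sp(a)`
(admissible by F3c), which turns the hypothesis into the `Hom`-form hypothesis of F3d.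
[cite: HenniartBSMF2002, Thm. 1.7 (a)] [cite: TateCorvallis1979, (4.1.5)] -/
theorem isEquivalent_of_finrank_invariants_tprod_eq :
    ∀ (F : Type) [Field F] [ValuativeRel F] [TopologicalSpace F] [IsNonarchimedeanLocalField F] (n : ℕ), 2 ≤ n → ∀ (σ σ' : WeilDeligneRep F ℂ (Fin n → ℂ)), σ.IsFrobSemisimple → σ'.IsFrobSemisimple → ¬ σ.IsIrreducible → (∀ (r : ℕ), 0 < r → r < n → ∀ τ : WeilDeligneRep F ℂ (Fin r → ℂ), τ.IsFrobSemisimple → τ.IsIndecomposable → Module.finrank ℂ ↥(LinearMap.ker (σ.tprod τ).N ⊓ (σ.tprod τ).ρ.invariants) = Module.finrank ℂ ↥(LinearMap.ker (σ'.tprod τ).N ⊓ (σ'.tprod τ).ρ.invariants)) → σ.IsEquivalent σ' := by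
  intro F _ _ _ _ n hn σ σ' hσ hσ' hirr H
  refine stub_isEquivalent_of_finrank_homWD_stringModel_eq F n hn σ σ' hσ hσ' hirr ?_
  intro Hd _ _ _ ρ hρ hirrρ a ha hlt
  obtain ⟨hss, hind⟩ := stringModel_admissible F Hd ρ hρ hirrρ a ha
  obtain ⟨τ, hτss, hτind, hτ⟩ :=
    dualProbe F (Fin a → Hd) (Summit.Langlands.Langlands.Theorems.ReciprocityUpToIrreducibilityR.stringModel ρ hρ a)
  have hr : Module.finrank ℂ (Fin a → Hd) = a * Module.finrank ℂ Hd := by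
    simp [Module.finrank_pi_fintype]
  have hpos : 0 < Module.finrank ℂ Hd := by
    have : Nontrivial Hd := by
      by_contra hH
      haveI : Subsingleton Hd := not_nontrivial_iff_subsingleton.mp hH
      haveI : Subsingleton (Subrepresentation ρ) :=
        ⟨fun p q => Subrepresentation.toSubmodule_injective (Subsingleton.elim _ _)⟩
      haveI := hirrρ.toNontrivial
      exact false_of_nontrivial_of_subsingleton (Subrepresentation ρ)
    exact Module.finrank_pos
  have h0 : 0 < Module.finrank ℂ (Fin a → Hd) := by rw [hr]; exact Nat.mul_pos ha hpos
  have hn' : Module.finrank ℂ (Fin a → Hd) < n := by rw [hr]; exact hlt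
  rw [← hτ (Fin n → ℂ) σ, ← hτ (Fin n → ℂ) σ']
  exact H _ h0 hn' τ (hτss hss) (hτind hind)

/-- **Henniart 2002, Thm. 1.7 (a), Galois side, root-multiplicity form** (the Literature named fact
`Henniart2002_isEquivalent_of_rootMultiplicity_eulerFactor_tprod_eq` at every non-archimedean local field; =
18745's registered `stub_henniart2002_thm17a` and 17925's `henniart2002_thm17a`, same glue): pole orders of
`L(s, σ ⊗ τ)` at `s = 0` are the dimensions of the Weil–Deligne invariants (LANDED p162414), and those determine
`σ` (F3).  Sorry-free modulo F3a/F3c/F3d. [cite: HenniartBSMF2002, Thm. 1.7 (a)] -/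
theorem henniart2002_thm17a :
    ∀ (F : Type) [Field F] [ValuativeRel F] [TopologicalSpace F] [IsNonarchimedeanLocalField F],
      Henniart2002_isEquivalent_of_rootMultiplicity_eulerFactor_tprod_eq F := by
  intro F _ _ _ _ hn hex n hn2 σ σ' hσ hσ' hirr H
  refine isEquivalent_of_finrank_invariants_tprod_eq F n hn2 σ σ' hσ hσ' hirr ?_
  intro r hr hrn τ hτ hτi
  rw [← Summit.Langlands.Langlands.Theorems.ReciprocityUpToIrreducibilityR.stub_rootMultiplicity_eulerFactor_tprod_eq_finrank
      F hn hex _ _ σ τ hσ hτ,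
    ← Summit.Langlands.Langlands.Theorems.ReciprocityUpToIrreducibilityR.stub_rootMultiplicity_eulerFactor_tprod_eq_finrank
      F hn hex _ _ σ' τ hσ' hτ]
  exact H r hr hrn τ hτ hτi

/-- **(F2 ∧ F3) — Henniart 2002 inputs of piece U** (the former conjunction stub
`stub_henniart2002_localLanglandsInputs`, now DERIVED from LNF (F2) and F3): (F2)
`localLanglands_gl_indecomposable` and (F3) `Henniart2002_isEquivalent_of_rootMultiplicity_eulerFactor_tprod_eq`, at
every local field. [cite: HenniartBSMF2002, Thm. 1.5 (i), Thm. 1.7 (a), §2.7, §2.9] -/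
theorem henniart2002_localLanglandsInputs :
    (∀ (F : Type) [Field F] [ValuativeRel F] [TopologicalSpace F] [IsNonarchimedeanLocalField F]
      (hmul : @IsFrobPow.mul F _ _ _ _) (huniq : @IsFrobPow.unique F _ _ _ _)
      (hn : absInertia_normal F) (hex : @exists_isFrobPow F _ _ _ _)
      (hns : @WeilGroup.exists_subgroup_le_inertia_isOpen_of_continuous F _ _ _ _)
      (d : LocalArtinData F) (𝓔 : LocalEpsilonSystem F) (hd : 𝓔.artin F = d),
      localLanglands_gl_indecomposable F hmul huniq hn hex hns d 𝓔 hd) ∧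
    (∀ (F : Type) [Field F] [ValuativeRel F] [TopologicalSpace F] [IsNonarchimedeanLocalField F],
      Henniart2002_isEquivalent_of_rootMultiplicity_eulerFactor_tprod_eq F) :=
  ⟨localLanglands_gl_indecomposable_all, henniart2002_thm17a⟩

/-- **(Fν) — the invariant measure on `GL_m(F) ⧸ U_m(F)`: CLOSED.**  The former stub
`stub_exists_smulInvariantMeasure_glQuotUpperUnitriangular` (the Literature named fact
`exists_smulInvariantMeasure_glQuotUpperUnitriangular`, p157147, at every local field) was LANDED by the lead of crux
stmt-Langlands-17925 as p159583 `Theorems/PhantomRMYoshidaPhantomRMJunctionInvariantMeasureGLQuot.lean` (transport of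
their proved p158762, Weil's quotient measure for the unimodular pair `GL_m(F) ⊇ U_m(F)` via the tree's
`Literature.MeasureTheory.Group.quotientMeasure`); cited here by name. [cite: Loomis1953, §33D Theorem and §33B] -/
theorem exists_smulInvariantMeasure_glQuotUpperUnitriangular_all :
    ∀ (F : Type) [Field F] [ValuativeRel F] [TopologicalSpace F] [IsNonarchimedeanLocalField F],
      exists_smulInvariantMeasure_glQuotUpperUnitriangular F :=
  Summit.Langlands.Langlands.Theorems.PhantomRMJunctionOfPieces.stub_exists_smulInvariantMeasure_glQuotUpperUnitriangular

/-- **Stub W_irr — weak existence of an irreducible pinned-geometric avatar** (Buzzard–Gee Conj 3.2.2, weak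
form, with irreducibility; `Rec`-free). [cite: BuzzardGeeLMS2014, Conj. 3.2.2] -/
theorem stub_weakExistenceIrreducible :
    ∀ (K : Type) [Field K] [NumberField K] (n : ℕ) (hcpt : Literature.NumberTheory.Automorphic.isCompact_glFiniteIntegralLevel n K), 0 < n → ∀ π : Literature.NumberTheory.Automorphic.CuspidalAutomorphicRepData n K hcpt, π.1.IsLAlgebraic → ∀ (ℓ : ℕ) [Fact ℓ.Prime] (ι : PadicAlgCl ℓ ≃+* ℂ), ∃ ρ : Literature.NumberTheory.GaloisRepresentations.FramedGaloisRep K (PadicAlgCl ℓ) n, ρ.toGaloisRep.IsIrreducible ∧ ((∀ᶠ v : IsDedekindDomain.HeightOneSpectrum (NumberField.RingOfIntegers K) in Filter.cofinite, ρ.IsUnramifiedAt v) ∧ ∀ (v : IsDedekindDomain.HeightOneSpectrum (NumberField.RingOfIntegers K)) (hv : ((ℓ : ℕ) : NumberField.RingOfIntegers K) ∈ v.asIdeal), (Literature.NumberTheory.PAdicHodge.fontainePstAdicCompletion v ℓ hv).IsDeRhamFramed (ρ.toLocal v)) ∧ ∀ᶠ v : IsDedekindDomain.HeightOneSpectrum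 (NumberField.RingOfIntegers K) in Filter.cofinite, Summit.Langlands.SatakeFrobCompatibleAt ι π.1 ρ v := by
  sorry

/-- **Stub LGC_∃ — local–global compatibility at every finite place for irreducible a.e.-compatible pairs,
for SOME pinned reciprocity datum** (Taylor 2004 Conj 7; Harris–Taylor / Taylor–Yoshida / Caraiani in the
regular polarised case). [cite: TaylorGaloisRepresentations2004, Conj. 7] [cite: HarrisTaylorAMS2001, Thm. A] -/
theorem stub_pairCompatibility :
    ∀ (K : Type) [Field K] [NumberField K], Nonempty (Summit.Langlands.ReciprocityData K) → ∃ Rec : Summit.Langlands.ReciprocityData K, ∀ (n : ℕ) (hcpt : Literature.NumberTheory.Automorphic.isCompact_glFiniteIntegralLevel n K), 0 < n → ∀ (π : Literature.NumberTheory.Automorphic.CuspidalAutomorphicRepData n K hcpt), π.1.IsLAlgebraic → ∀ (ℓ : ℕ) [Fact ℓ.Prime] (ι : PadicAlgCl ℓ ≃+* ℂ) (ρ : Literature.NumberTheory.GaloisRepresentations.FramedGaloisRep K (PadicAlgCl ℓ) n), ρ.toGaloisRep.IsIrreducible → ((∀ᶠ v : IsDedekindDomain.HeightOneSpectrum (NumberField.RingOfIntegers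 K) in Filter.cofinite, ρ.IsUnramifiedAt v) ∧ ∀ (v : IsDedekindDomain.HeightOneSpectrum (NumberField.RingOfIntegers K)) (hv : ((ℓ : ℕ) : NumberField.RingOfIntegers K) ∈ v.asIdeal), (Literature.NumberTheory.PAdicHodge.fontainePstAdicCompletion v ℓ hv).IsDeRhamFramed (ρ.toLocal v)) → (∀ᶠ v : IsDedekindDomain.HeightOneSpectrum (NumberField.RingOfIntegers K) in Filter.cofinite, Summit.Langlands.SatakeFrobCompatibleAt ι π.1 ρ v) → ∀ v : IsDedekindDomain.HeightOneSpectrum (NumberField.RingOfIntegers K), Summit.Langlands.LocalGlobalCompatibleAt Rec ι π.1 ρ v := by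
  sorry

/-- **Stub — conjugacy of avatars** (THEOREM: Chebotarev + Brauer–Nesbitt + transfer of irreducibility).
CLOSED: corollary of the landed `ReciprocityUpToIrreducibility.isConjugate_of_satakeFrobCompatibleAt`
(crux stmt-Langlands-14328); LANDED for this line p150228 `Theorems/PhantomRMYoshidaPhantomRMJunctionStubAvatarConjugate.lean`, cited here by name.
[cite: DeligneSerreASENS1974, Lemme 3.2] -/
theorem stub_avatarConjugate :
    ∀ (K : Type) [Field K] [NumberField K] (Rec : Summit.Langlands.ReciprocityData K) (n : ℕ) (hcpt : Literature.NumberTheory.Automorphic.isCompact_glFiniteIntegralLevel n K) (ℓ : ℕ) [Fact ℓ.Prime] (ι : PadicAlgCl ℓ ≃+* ℂ) (π : Literature.NumberTheory.Automorphic.CuspidalAutomorphicRepData n K hcpt) (ρ ρ' : Literature.NumberTheory.GaloisRepresentations.FramedGaloisRep K (PadicAlgCl ℓ) n), ρ.toGaloisRep.IsIrreducible → Summit.Langlands.Corresponds Rec ι π.1 ρ → Summit.Langlands.Corresponds Rec ι π.1 ρ' → Summit.Langlands.IsConjugate ρ ρ' :=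
  -- = `Summit.Langlands.Langlands.Theorems.PhantomRMJunctionOfPieces.stub_avatarConjugate` (LANDED p150228); re-proved
  -- inline so that this workfile does not wait for the farm to build that module
  fun _K _ _ _Rec _n _hcpt _ℓ _ ι π _ρ _ρ' hirr h h' ↦
    Summit.Langlands.Langlands.Theorems.ReciprocityUpToIrreducibility.isConjugate_of_satakeFrobCompatibleAt
      π.1 ι hirr h.1 h'.1

/-- **Stub B_w — weak automorphy of irreducible pinned-geometric representations** (Fontaine–Mazur–Langlands,
a.e. form; `Rec`-free). [cite: FontaineMazurGeometric1995, Conj. 1] [cite: BuzzardGeeLMS2014, Conj. 3.2.2] -/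
theorem stub_weakAutomorphy :
    ∀ (K : Type) [Field K] [NumberField K] (n : ℕ) (hcpt : Literature.NumberTheory.Automorphic.isCompact_glFiniteIntegralLevel n K), 0 < n → ∀ (ℓ : ℕ) [Fact ℓ.Prime] (ι : PadicAlgCl ℓ ≃+* ℂ) (ρ : Literature.NumberTheory.GaloisRepresentations.FramedGaloisRep K (PadicAlgCl ℓ) n), ρ.toGaloisRep.IsIrreducible → ((∀ᶠ v : IsDedekindDomain.HeightOneSpectrum (NumberField.RingOfIntegers K) in Filter.cofinite, ρ.IsUnramifiedAt v) ∧ ∀ (v : IsDedekindDomain.HeightOneSpectrum (NumberField.RingOfIntegers K)) (hv : ((ℓ : ℕ) : NumberField.RingOfIntegers K) ∈ v.asIdeal), (Literature.NumberTheory.PAdicHodge.fontainePstAdicCompletion v ℓ hv).IsDeRhamFramed (ρ.toLocal v)) → ∃ π : Literature.NumberTheory.Automorphic.CuspidalAutomorphicRepData n K hcpt, π.1.IsLAlgebraic ∧ ∀ᶠ v : IsDedekindDomain.HeightOneSpectrum (NumberField.RingOfIntegers K) in Filter.cofinite, Summit.Langlands.SatakeFrobCompatibleAt ι π.1 ρ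 v := by
  sorry

/-! ## §1 Piece N from S_N1, S_N2 (strategist's birth composition, verbatim) -/

/-- **N from the two stub STATEMENTS**, concluding the TEXT of the piece (= item stmt-Langlands-17930 =
the child `PhantomRMYoshida.CanonicalReciprocityData` once the split is installed; all definitionally equal).
Sorry-free: package, per completion, the datum `(𝓔.artin F_v, 𝓔, rec)` with the discharged threaded facts,
then `choose` over `v`. -/
theorem canonicalReciprocityData_text_of
    (heps : ∀ (F : Type) [Field F] [ValuativeRel F] [TopologicalSpace F] [IsNonarchimedeanLocalField F],
      ∃ 𝓔 : LocalEpsilonSystem F, ∀ (E : Type) [Field E] [ValuativeRel E] [TopologicalSpace E]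
        [IsNonarchimedeanLocalField E] [Algebra F E] [FiniteDimensional F E],
          (𝓔.artin E).IsCanonical)
    (hgl : ∀ (F : Type) [Field F] [ValuativeRel F] [TopologicalSpace F] [IsNonarchimedeanLocalField F]
      (hmul : IsFrobPow.mul (F := F)) (huniq : IsFrobPow.unique (F := F))
      (hn : absInertia_normal F) (hex : exists_isFrobPow (F := F))
      (hns : WeilGroup.exists_subgroup_le_inertia_isOpen_of_continuous (F := F))
      (d : LocalArtinData F) (𝓔 : LocalEpsilonSystem F) (hd : 𝓔.artin F = d),
      localLanglands_gl F hmul huniq hn hex hns d 𝓔 hd) :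
    ∀ (K : Type) [Field K] [NumberField K], Nonempty (Summit.Langlands.ReciprocityData K) := by
  intro K _ _
  have key : ∀ v : HeightOneSpectrum (𝓞 K), ∃ L : LocalLanglandsDatum (v.adicCompletion K),
      L.artin.IsCanonical ∧ ∀ (E : Type) [Field E] [ValuativeRel E] [TopologicalSpace E]
        [IsNonarchimedeanLocalField E] [Algebra (v.adicCompletion K) E]
        [FiniteDimensional (v.adicCompletion K) E], (L.eps.artin E).IsCanonical := by
    intro v
    obtain ⟨𝓔, h𝓔⟩ := heps (v.adicCompletion K)
    obtain ⟨rec, hrec, -⟩ := hgl (v.adicCompletion K) IsFrobPow.mul_holds IsFrobPow.unique_holds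
      (absInertia_normal_holds _) (exists_isFrobPow_holds _)
      WeilGroup.exists_subgroup_le_inertia_isOpen_of_continuous_holds (𝓔.artin _) 𝓔 rfl
    exact ⟨{ hmul := IsFrobPow.mul_holds, huniq := IsFrobPow.unique_holds,
             hn := absInertia_normal_holds _, hex := exists_isFrobPow_holds _,
             hns := WeilGroup.exists_subgroup_le_inertia_isOpen_of_continuous_holds,
             hqc := isOpen_ker_quasiChar_holds, artin := 𝓔.artin _, eps := 𝓔, eps_artin := rfl,
             recGL := rec, isLocalLanglands := hrec },
      h𝓔 _, fun E _ _ _ _ _ _ ↦ h𝓔 E⟩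
  choose L hL hLE using key
  exact ⟨⟨L, hL, fun v E _ _ _ _ _ _ ↦ hLE v E⟩⟩

/-! ## §2 Piece U — PROVED from S6, (F2 ∧ F3) and (Fν): generic rigidity of pinned data in every rank.
LANDED p157386 `Theorems/PhantomRMYoshidaPhantomRMJunctionGenericRigidity.lean` (lead c18; strong induction on the rank
against (F2)'s witness, `rec_eq_sharp_of_isGeneric`; registered stubs `pinnedRecRigidity_of_localLanglandsInputs` and,
by name over the Literature facts, `recGL_eq_of_isGeneric_of_namedFacts`), imported by name. -/

/-- **Piece U (text) from S6, (F2 ∧ F3) and (Fν), the named facts BY NAME** (the landed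
`pinnedRecRigidity_of_localLanglandsInputs`; the named facts unfold definitionally to its spelled hypotheses).
[cite: HenniartBSMF2002, Thm. 1.5 and Thm. 1.7 (a)] [cite: Henniarts1993, Thm 1.1] [cite: HarrisTaylorAMS2001, Thm. A] -/
theorem pinnedRecRigidity_text_of
    (hgl : ∀ (F : Type) [Field F] [ValuativeRel F] [TopologicalSpace F] [IsNonarchimedeanLocalField F]
      (hmul : @IsFrobPow.mul F _ _ _ _) (huniq : @IsFrobPow.unique F _ _ _ _)
      (hn : absInertia_normal F) (hex : @exists_isFrobPow F _ _ _ _)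
      (hns : @WeilGroup.exists_subgroup_le_inertia_isOpen_of_continuous F _ _ _ _)
      (d : LocalArtinData F) (𝓔 : LocalEpsilonSystem F) (hd : 𝓔.artin F = d),
      localLanglands_gl F hmul huniq hn hex hns d 𝓔 hd)
    (hH : (∀ (F : Type) [Field F] [ValuativeRel F] [TopologicalSpace F] [IsNonarchimedeanLocalField F]
      (hmul : @IsFrobPow.mul F _ _ _ _) (huniq : @IsFrobPow.unique F _ _ _ _)
      (hn : absInertia_normal F) (hex : @exists_isFrobPow F _ _ _ _)
      (hns : @WeilGroup.exists_subgroup_le_inertia_isOpen_of_continuous F _ _ _ _)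
      (d : LocalArtinData F) (𝓔 : LocalEpsilonSystem F) (hd : 𝓔.artin F = d),
      localLanglands_gl_indecomposable F hmul huniq hn hex hns d 𝓔 hd) ∧
      (∀ (F : Type) [Field F] [ValuativeRel F] [TopologicalSpace F] [IsNonarchimedeanLocalField F],
        Henniart2002_isEquivalent_of_rootMultiplicity_eulerFactor_tprod_eq F))
    (hν : ∀ (F : Type) [Field F] [ValuativeRel F] [TopologicalSpace F] [IsNonarchimedeanLocalField F],
      exists_smulInvariantMeasure_glQuotUpperUnitriangular F) :
    ∀ (K : Type) [Field K] [NumberField K] (Rec Rec' : Summit.Langlands.ReciprocityData K) (v : IsDedekindDomain.HeightOneSpectrum (NumberField.RingOfIntegers K)) (n : ℕ) (πv : Literature.NumberTheory.Automorphic.SmoothIrrep (GL (Fin n) (v.adicCompletion K))) (ψ : AddChar (v.adicCompletion K) Circle), ψ.IsContinuousNontrivial → Literature.NumberTheory.Automorphic.IsGeneric πv.ρ ψ → (Rec.llc v).recGL n (Literature.NumberTheory.Automorphic.IrrClass.mk πv) = (Rec'.llc v).recGL n (Literature.NumberTheory.Automorphic.IrrClass.mk πv) :=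
  Summit.Langlands.Langlands.Theorems.PhantomRMJunctionOfPieces.pinnedRecRigidity_of_localLanglandsInputs hgl
    ⟨fun F _ _ _ _ hmul huniq hn hex hns d 𝓔 hd => hH.1 F hmul huniq hn hex hns d 𝓔 hd, fun F _ _ _ _ => hH.2 F⟩
    (fun F _ _ _ _ m _ _ => hν F m)

/-! ## §3 Pieces A′ and B′ from W_irr, LGC_∃, avatar conjugacy, B_w (strategist's birth compositions, verbatim) -/

/-- **A′ from the stub STATEMENTS**, concluding the TEXT of the piece. -/
theorem automorphicToGaloisOfDatum_text_of
    (hW : ∀ (K : Type) [Field K] [NumberField K] (n : ℕ) (hcpt : Literature.NumberTheory.Automorphic.isCompact_glFiniteIntegralLevel n K), 0 < n → ∀ π : Literature.NumberTheory.Automorphic.CuspidalAutomorphicRepData n K hcpt, π.1.IsLAlgebraic → ∀ (ℓ : ℕ) [Fact ℓ.Prime] (ι : PadicAlgCl ℓ ≃+* ℂ), ∃ ρ : Literature.NumberTheory.GaloisRepresentations.FramedGaloisRep K (PadicAlgCl ℓ) n, ρ.toGaloisRep.IsIrreducible ∧ ((∀ᶠ v : IsDedekindDomain.HeightOneSpectrum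 (NumberField.RingOfIntegers K) in Filter.cofinite, ρ.IsUnramifiedAt v) ∧ ∀ (v : IsDedekindDomain.HeightOneSpectrum (NumberField.RingOfIntegers K)) (hv : ((ℓ : ℕ) : NumberField.RingOfIntegers K) ∈ v.asIdeal), (Literature.NumberTheory.PAdicHodge.fontainePstAdicCompletion v ℓ hv).IsDeRhamFramed (ρ.toLocal v)) ∧ ∀ᶠ v : IsDedekindDomain.HeightOneSpectrum (NumberField.RingOfIntegers K) in Filter.cofinite, Summit.Langlands.SatakeFrobCompatibleAt ι π.1 ρ v)
    (hL : ∀ (K : Type) [Field K] [NumberField K], Nonempty (Summit.Langlands.ReciprocityData K) → ∃ Rec : Summit.Langlands.ReciprocityData K, ∀ (n : ℕ) (hcpt : Literature.NumberTheory.Automorphic.isCompact_glFiniteIntegralLevel n K), 0 < n → ∀ (π : Literature.NumberTheory.Automorphic.CuspidalAutomorphicRepData n K hcpt), π.1.IsLAlgebraic → ∀ (ℓ : ℕ) [Fact ℓ.Prime] (ι : PadicAlgCl ℓ ≃+* ℂ) (ρ : Literature.NumberTheory.GaloisRepresentations.FramedGaloisRep K (PadicAlgCl ℓ) n), ρ.toGaloisRep.IsIrreducible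 → ((∀ᶠ v : IsDedekindDomain.HeightOneSpectrum (NumberField.RingOfIntegers K) in Filter.cofinite, ρ.IsUnramifiedAt v) ∧ ∀ (v : IsDedekindDomain.HeightOneSpectrum (NumberField.RingOfIntegers K)) (hv : ((ℓ : ℕ) : NumberField.RingOfIntegers K) ∈ v.asIdeal), (Literature.NumberTheory.PAdicHodge.fontainePstAdicCompletion v ℓ hv).IsDeRhamFramed (ρ.toLocal v)) → (∀ᶠ v : IsDedekindDomain.HeightOneSpectrum (NumberField.RingOfIntegers K) in Filter.cofinite, Summit.Langlands.SatakeFrobCompatibleAt ι π.1 ρ v) → ∀ v : IsDedekindDomain.HeightOneSpectrum (NumberField.RingOfIntegers K), Summit.Langlands.LocalGlobalCompatibleAt Rec ι π.1 ρ v)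
    (hU : ∀ (K : Type) [Field K] [NumberField K] (Rec : Summit.Langlands.ReciprocityData K) (n : ℕ) (hcpt : Literature.NumberTheory.Automorphic.isCompact_glFiniteIntegralLevel n K) (ℓ : ℕ) [Fact ℓ.Prime] (ι : PadicAlgCl ℓ ≃+* ℂ) (π : Literature.NumberTheory.Automorphic.CuspidalAutomorphicRepData n K hcpt) (ρ ρ' : Literature.NumberTheory.GaloisRepresentations.FramedGaloisRep K (PadicAlgCl ℓ) n), ρ.toGaloisRep.IsIrreducible → Summit.Langlands.Corresponds Rec ι π.1 ρ → Summit.Langlands.Corresponds Rec ι π.1 ρ' → Summit.Langlands.IsConjugate ρ ρ') :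
    ∀ (F : Type) [Field F] [NumberField F], Nonempty (Summit.Langlands.ReciprocityData F) → ∃ Rec : Summit.Langlands.ReciprocityData F, ∀ n : ℕ, 0 < n → ∀ hcpt : Literature.NumberTheory.Automorphic.isCompact_glFiniteIntegralLevel n F, Summit.Langlands.AutomorphicToGalois n Rec hcpt := by
  intro F _ _ hne
  obtain ⟨Rec, hRec⟩ := hL F hne
  refine ⟨Rec, fun n hn hcpt π hLalg ℓ _ ι ↦ ?_⟩
  obtain ⟨ρ, hirr, hgeo, hsat⟩ := hW F n hcpt hn π hLalg ℓ ι
  have hcorr : Corresponds Rec ι π.1 ρ := ⟨hsat, hRec n hcpt hn π hLalg ℓ ι ρ hirr hgeo hsat⟩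
  exact ⟨ρ, hirr, hgeo, hcorr, fun ρ' h' ↦ hU F Rec n hcpt ℓ ι π ρ ρ' hirr hcorr h'⟩

/-- **B′ from the stub STATEMENTS**, concluding the TEXT of the piece. -/
theorem galoisToAutomorphicOfDatum_text_of
    (hB : ∀ (K : Type) [Field K] [NumberField K] (n : ℕ) (hcpt : Literature.NumberTheory.Automorphic.isCompact_glFiniteIntegralLevel n K), 0 < n → ∀ (ℓ : ℕ) [Fact ℓ.Prime] (ι : PadicAlgCl ℓ ≃+* ℂ) (ρ : Literature.NumberTheory.GaloisRepresentations.FramedGaloisRep K (PadicAlgCl ℓ) n), ρ.toGaloisRep.IsIrreducible → ((∀ᶠ v : IsDedekindDomain.HeightOneSpectrum (NumberField.RingOfIntegers K) in Filter.cofinite, ρ.IsUnramifiedAt v) ∧ ∀ (v : IsDedekindDomain.HeightOneSpectrum (NumberField.RingOfIntegers K)) (hv : ((ℓ : ℕ) : NumberField.RingOfIntegers K) ∈ v.asIdeal), (Literature.NumberTheory.PAdicHodge.fontainePstAdicCompletion v ℓ hv).IsDeRhamFramed (ρ.toLocal v)) → ∃ π : Literature.NumberTheory.Automorphic.CuspidalAutomorphicRepData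 n K hcpt, π.1.IsLAlgebraic ∧ ∀ᶠ v : IsDedekindDomain.HeightOneSpectrum (NumberField.RingOfIntegers K) in Filter.cofinite, Summit.Langlands.SatakeFrobCompatibleAt ι π.1 ρ v)
    (hL : ∀ (K : Type) [Field K] [NumberField K], Nonempty (Summit.Langlands.ReciprocityData K) → ∃ Rec : Summit.Langlands.ReciprocityData K, ∀ (n : ℕ) (hcpt : Literature.NumberTheory.Automorphic.isCompact_glFiniteIntegralLevel n K), 0 < n → ∀ (π : Literature.NumberTheory.Automorphic.CuspidalAutomorphicRepData n K hcpt), π.1.IsLAlgebraic → ∀ (ℓ : ℕ) [Fact ℓ.Prime] (ι : PadicAlgCl ℓ ≃+* ℂ) (ρ : Literature.NumberTheory.GaloisRepresentations.FramedGaloisRep K (PadicAlgCl ℓ) n), ρ.toGaloisRep.IsIrreducible → ((∀ᶠ v : IsDedekindDomain.HeightOneSpectrum (NumberField.RingOfIntegers K) in Filter.cofinite, ρ.IsUnramifiedAt v) ∧ ∀ (v : IsDedekindDomain.HeightOneSpectrum (NumberField.RingOfIntegers K)) (hv : ((ℓ : ℕ) : NumberField.RingOfIntegers K) ∈ v.asIdeal),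 (Literature.NumberTheory.PAdicHodge.fontainePstAdicCompletion v ℓ hv).IsDeRhamFramed (ρ.toLocal v)) → (∀ᶠ v : IsDedekindDomain.HeightOneSpectrum (NumberField.RingOfIntegers K) in Filter.cofinite, Summit.Langlands.SatakeFrobCompatibleAt ι π.1 ρ v) → ∀ v : IsDedekindDomain.HeightOneSpectrum (NumberField.RingOfIntegers K), Summit.Langlands.LocalGlobalCompatibleAt Rec ι π.1 ρ v) :
    ∀ (F : Type) [Field F] [NumberField F], Nonempty (Summit.Langlands.ReciprocityData F) → ∃ Rec : Summit.Langlands.ReciprocityData F, ∀ n : ℕ, 0 < n → ∀ hcpt : Literature.NumberTheory.Automorphic.isCompact_glFiniteIntegralLevel n F, Summit.Langlands.GaloisToAutomorphic n Rec hcpt := by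
  intro F _ _ hne
  obtain ⟨Rec, hRec⟩ := hL F hne
  refine ⟨Rec, fun n hn hcpt ℓ _ ι ρ hirr hgeo ↦ ?_⟩
  obtain ⟨π, hLalg, hsat⟩ := hB F n hcpt hn ℓ ι ρ hirr hgeo
  exact ⟨π, hLalg, hsat, hRec n hcpt hn π hLalg ℓ ι ρ hirr hgeo hsat⟩

/-! ## §4 The strategist's glue — LANDED p150610 as `Theorems/PhantomRMYoshidaPhantomRMJunctionSplit.lean`
(`Summit.Langlands.Langlands.Theorems.PhantomRMYoshidaJunctionSplit.langlands_of_pieces`), imported by name. -/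

/-! ## §5 The crux BY NAME -/

/-- **`PhantomRMYoshida.PhantomRMJunction` from the eight piece INPUTS** (N from S_N1+S6, U from S6 + (F2 ∧ F3) +
(Fν), A′ from W_irr+LGC_∃+conjugacy, B′ from B_w+LGC_∃, then the transport glue; the sector hypothesis is discarded).
[cite: BuzzardGeeLMS2014, Conj. 3.2.1 and Conj. 3.2.2] [cite: FontaineMazurGeometric1995, Conj. 1]
[cite: Henniarts1993, Thm 1.1] [cite: HarrisTaylorAMS2001, Thm. A] [cite: HenniartBSMF2002, Thm. 1.7 (a)] -/
theorem PhantomRMJunction_of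
    (hN1 : ∀ (F : Type) [Field F] [ValuativeRel F] [TopologicalSpace F] [IsNonarchimedeanLocalField F],
      ∃ 𝓔 : LocalEpsilonSystem F, ∀ (E : Type) [Field E] [ValuativeRel E] [TopologicalSpace E]
        [IsNonarchimedeanLocalField E] [Algebra F E] [FiniteDimensional F E],
          (𝓔.artin E).IsCanonical)
    (hgl : ∀ (F : Type) [Field F] [ValuativeRel F] [TopologicalSpace F] [IsNonarchimedeanLocalField F]
      (hmul : @IsFrobPow.mul F _ _ _ _) (huniq : @IsFrobPow.unique F _ _ _ _)
      (hn : absInertia_normal F) (hex : @exists_isFrobPow F _ _ _ _)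
      (hns : @WeilGroup.exists_subgroup_le_inertia_isOpen_of_continuous F _ _ _ _)
      (d : LocalArtinData F) (𝓔 : LocalEpsilonSystem F) (hd : 𝓔.artin F = d),
      localLanglands_gl F hmul huniq hn hex hns d 𝓔 hd)
    (hH : (∀ (F : Type) [Field F] [ValuativeRel F] [TopologicalSpace F] [IsNonarchimedeanLocalField F]
      (hmul : @IsFrobPow.mul F _ _ _ _) (huniq : @IsFrobPow.unique F _ _ _ _)
      (hn : absInertia_normal F) (hex : @exists_isFrobPow F _ _ _ _)
      (hns : @WeilGroup.exists_subgroup_le_inertia_isOpen_of_continuous F _ _ _ _)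
      (d : LocalArtinData F) (𝓔 : LocalEpsilonSystem F) (hd : 𝓔.artin F = d),
      localLanglands_gl_indecomposable F hmul huniq hn hex hns d 𝓔 hd) ∧
      (∀ (F : Type) [Field F] [ValuativeRel F] [TopologicalSpace F] [IsNonarchimedeanLocalField F],
        Henniart2002_isEquivalent_of_rootMultiplicity_eulerFactor_tprod_eq F))
    (hν : ∀ (F : Type) [Field F] [ValuativeRel F] [TopologicalSpace F] [IsNonarchimedeanLocalField F],
      exists_smulInvariantMeasure_glQuotUpperUnitriangular F)
    (hW : ∀ (K : Type) [Field K] [NumberField K] (n : ℕ) (hcpt : Literature.NumberTheory.Automorphic.isCompact_glFiniteIntegralLevel n K), 0 < n → ∀ π : Literature.NumberTheory.Automorphic.CuspidalAutomorphicRepData n K hcpt, π.1.IsLAlgebraic → ∀ (ℓ : ℕ) [Fact ℓ.Prime] (ι : PadicAlgCl ℓ ≃+* ℂ), ∃ ρ : Literature.NumberTheory.GaloisRepresentations.FramedGaloisRep K (PadicAlgCl ℓ) n, ρ.toGaloisRep.IsIrreducible ∧ ((∀ᶠ v : IsDedekindDomain.HeightOneSpectrum (NumberField.RingOfIntegers K)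 in Filter.cofinite, ρ.IsUnramifiedAt v) ∧ ∀ (v : IsDedekindDomain.HeightOneSpectrum (NumberField.RingOfIntegers K)) (hv : ((ℓ : ℕ) : NumberField.RingOfIntegers K) ∈ v.asIdeal), (Literature.NumberTheory.PAdicHodge.fontainePstAdicCompletion v ℓ hv).IsDeRhamFramed (ρ.toLocal v)) ∧ ∀ᶠ v : IsDedekindDomain.HeightOneSpectrum (NumberField.RingOfIntegers K) in Filter.cofinite, Summit.Langlands.SatakeFrobCompatibleAt ι π.1 ρ v)
    (hL : ∀ (K : Type) [Field K] [NumberField K], Nonempty (Summit.Langlands.ReciprocityData K) → ∃ Rec : Summit.Langlands.ReciprocityData K, ∀ (n : ℕ) (hcpt : Literature.NumberTheory.Automorphic.isCompact_glFiniteIntegralLevel n K), 0 < n → ∀ (π : Literature.NumberTheory.Automorphic.CuspidalAutomorphicRepData n K hcpt), π.1.IsLAlgebraic → ∀ (ℓ : ℕ) [Fact ℓ.Prime] (ι : PadicAlgCl ℓ ≃+* ℂ) (ρ : Literature.NumberTheory.GaloisRepresentations.FramedGaloisRep K (PadicAlgCl ℓ) n), ρ.toGaloisRep.IsIrreducible →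 ((∀ᶠ v : IsDedekindDomain.HeightOneSpectrum (NumberField.RingOfIntegers K) in Filter.cofinite, ρ.IsUnramifiedAt v) ∧ ∀ (v : IsDedekindDomain.HeightOneSpectrum (NumberField.RingOfIntegers K)) (hv : ((ℓ : ℕ) : NumberField.RingOfIntegers K) ∈ v.asIdeal), (Literature.NumberTheory.PAdicHodge.fontainePstAdicCompletion v ℓ hv).IsDeRhamFramed (ρ.toLocal v)) → (∀ᶠ v : IsDedekindDomain.HeightOneSpectrum (NumberField.RingOfIntegers K) in Filter.cofinite, Summit.Langlands.SatakeFrobCompatibleAt ι π.1 ρ v) → ∀ v : IsDedekindDomain.HeightOneSpectrum (NumberField.RingOfIntegers K), Summit.Langlands.LocalGlobalCompatibleAt Rec ι π.1 ρ v)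
    (hC : ∀ (K : Type) [Field K] [NumberField K] (Rec : Summit.Langlands.ReciprocityData K) (n : ℕ) (hcpt : Literature.NumberTheory.Automorphic.isCompact_glFiniteIntegralLevel n K) (ℓ : ℕ) [Fact ℓ.Prime] (ι : PadicAlgCl ℓ ≃+* ℂ) (π : Literature.NumberTheory.Automorphic.CuspidalAutomorphicRepData n K hcpt) (ρ ρ' : Literature.NumberTheory.GaloisRepresentations.FramedGaloisRep K (PadicAlgCl ℓ) n), ρ.toGaloisRep.IsIrreducible → Summit.Langlands.Corresponds Rec ι π.1 ρ → Summit.Langlands.Corresponds Rec ι π.1 ρ' → Summit.Langlands.IsConjugate ρ ρ')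
    (hBw : ∀ (K : Type) [Field K] [NumberField K] (n : ℕ) (hcpt : Literature.NumberTheory.Automorphic.isCompact_glFiniteIntegralLevel n K), 0 < n → ∀ (ℓ : ℕ) [Fact ℓ.Prime] (ι : PadicAlgCl ℓ ≃+* ℂ) (ρ : Literature.NumberTheory.GaloisRepresentations.FramedGaloisRep K (PadicAlgCl ℓ) n), ρ.toGaloisRep.IsIrreducible → ((∀ᶠ v : IsDedekindDomain.HeightOneSpectrum (NumberField.RingOfIntegers K) in Filter.cofinite, ρ.IsUnramifiedAt v) ∧ ∀ (v : IsDedekindDomain.HeightOneSpectrum (NumberField.RingOfIntegers K)) (hv : ((ℓ : ℕ) : NumberField.RingOfIntegers K) ∈ v.asIdeal), (Literature.NumberTheory.PAdicHodge.fontainePstAdicCompletion v ℓ hv).IsDeRhamFramed (ρ.toLocal v)) → ∃ π : Literature.NumberTheory.Automorphic.CuspidalAutomorphicRepData n K hcpt, π.1.IsLAlgebraic ∧ ∀ᶠ v : IsDedekindDomain.HeightOneSpectrum (NumberField.RingOfIntegers K) in Filter.cofinite, Summit.Langlands.SatakeFrobCompatibleAt ι π.1 ρ v) :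
    Summit.Langlands.Langlands.Theses.PhantomRMYoshida.PhantomRMJunction := by
  unfold Summit.Langlands.Langlands.Theses.PhantomRMYoshida.PhantomRMJunction
  intro _
  exact Summit.Langlands.Langlands.Theorems.PhantomRMYoshidaJunctionSplit.langlands_of_pieces
    (canonicalReciprocityData_text_of hN1 hgl) (pinnedRecRigidity_text_of hgl hH hν)
    (automorphicToGaloisOfDatum_text_of hW hL hC) (galoisToAutomorphicOfDatum_text_of hBw hL)

/-- **SKELETON COMPOSITION — the crux BY NAME from the registered stubs** (the only sorries of the file are inside
`stub_localNamedFacts`, `stub_isEquivalent_of_finrank_homWD_stringModel_eq`, `stub_weakExistenceIrreducible`,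
`stub_pairCompatibility`, `stub_weakAutomorphy`; `stub_avatarConjugate`, (Fν), F3a `dualProbe`, F3c `stringModel_admissible`
are closed). -/
theorem PhantomRMJunction_proof :
    Summit.Langlands.Langlands.Theses.PhantomRMYoshida.PhantomRMJunction :=
  PhantomRMJunction_of canonicalLocalConstants localLanglands_gl_all
    henniart2002_localLanglandsInputs exists_smulInvariantMeasure_glQuotUpperUnitriangular_all
    stub_weakExistenceIrreducible stub_pairCompatibility stub_avatarConjugate stub_weakAutomorphy

end Summit.Langlands.Langlands.Cruxes.PhantomRMJunction.OfPieces

end
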